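import Summits.MatrixMultiplication.MatrixMultiplication.Theorems.LevelGradedCohnUmansLevelOneGL2DesignsHermitianLiftCyclotomic
import Summits.MatrixMultiplication.MatrixMultiplication.Theorems.LevelGradedCohnUmansLevelOneGL2DesignsStubTangencySetsHermitianReduction

/-!
# The CM-Hermitian lift, part 3: tangency sets of size `p^{3/2 − 1/(r−1)}` for the primes `p ≡ 1 (mod r)`
(wall-breaker axis `Hermitian unital constructions`, stub `stub_tangencySets` of the crux `LevelOneGL2Designs`,
stmt-MatrixMultiplication-14080, k7 — file 5)

Assembly of the CM-Hermitian lift over `ℚ(ζ_r)` (`…HermitianLiftCyclotomic.exists_tangencySet_cyclotomicLift`): for every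
prime `r ≥ 3` there are `c > 0` and `q₀` such that EVERY prime `q ≥ q₀` with `q ≡ 1 (mod r)` carries

* an affine tangency set of `AG(2,q)` with `≥ c · q^{3/2 − 1/(r−1)}` points (`inducedMatchings_cmLift`), and hence
* a strong representative system in the exact flag format of `stub_tangencySets` with `≥ (c/2) · q^{3/2 − 1/(r−1)}`
  flags (`stubFormat_cmLift_progression`, via `FlagLine.TangencyHermitian.srs_of_tangencySet`).

Parameters: `m = r − 1 = [ℚ(ζ_r):ℚ]`, `A = (6r² + 4r)^m`, `C` maximal with `A·C^{2m} < q`, `D = C²`; the lift gives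
`C^{m}·(C²)^{m−1} = C^{3m−2}` points and maximality gives `q ≤ A·4^m·C^{2m}`, so `C^{3m−2} ≥ (A·4^m)^{−e} q^{e}` with
`e = (3m−2)/(2m) = 3/2 − 1/(r−1)` (`rpow_div_le_of_pow_le`).

Comparison (same conductor `r`, primes `q ≡ 1 (mod r)`): the parabola lift through the REAL subfield `ℚ(ζ_r)⁺`
(Pohoata, arXiv:2607.20422, Thm 1.3; in the tree `Literature…InducedMatchingsNearThreeHalves_holds`, k8) has exponent
`3/2 − 2/(r−1)`; the unital through the full CM field has `3/2 − 1/(r−1)` — `r = 5: 5/4` vs `1`, `r = 7: 4/3` vs `7/6`,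
`r = 11: 7/5` vs `13/10`, `r = 13: 17/12` vs `4/3`.  Letting `r → ∞` both give the stub's flag format at every exponent
`3/2 − ε` (`ParabolaLift.stubFormat_near_threeHalves`, already in the tree — not restated here); exponent exactly `3/2`
(the stub) remains the open frontier.  No definitions.
-/

-- the summit/problem path `MatrixMultiplication.MatrixMultiplication` is fixed by the tree layout (D-0017)
set_option linter.dupNamespace false

noncomputable section

open Finset Matrix NumberField

namespace Summit.MatrixMultiplication.MatrixMultiplication.Theorems.LevelOneGL2Designs.HermitianLift

/-- Exponent bookkeeping: from `x^a ≤ V` and `q ≤ A·x^b` (`b ≠ 0`) one gets `q^{a/b} ≤ A^{a/b}·V` over `ℝ`.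
[elementary] -/
theorem rpow_div_le_of_pow_le {q V x A a b : ℕ} (hb : b ≠ 0) (hx : x ^ a ≤ V) (hq : q ≤ A * x ^ b) :
    (q : ℝ) ^ ((a : ℝ) / b) ≤ (A : ℝ) ^ ((a : ℝ) / b) * V := by
  have hq' : (q : ℝ) ≤ (A : ℝ) * (x : ℝ) ^ (b : ℝ) := by
    rw [Real.rpow_natCast]; exact_mod_cast hq
  have he : 0 ≤ (a : ℝ) / b := by positivity
  calc (q : ℝ) ^ ((a : ℝ) / b) ≤ ((A : ℝ) * (x : ℝ) ^ (b : ℝ)) ^ ((a : ℝ) / b) :=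
        Real.rpow_le_rpow (Nat.cast_nonneg _) hq' he
    _ = (A : ℝ) ^ ((a : ℝ) / b) * ((x : ℝ) ^ (b : ℝ)) ^ ((a : ℝ) / b) :=
        Real.mul_rpow (Nat.cast_nonneg _) (by positivity)
    _ = (A : ℝ) ^ ((a : ℝ) / b) * (x : ℝ) ^ (a : ℕ) := by
        rw [← Real.rpow_mul (Nat.cast_nonneg _), ← Real.rpow_natCast]
        congr 2
        have : (b : ℝ) ≠ 0 := by exact_mod_cast hb
        field_simp
    _ ≤ (A : ℝ) ^ ((a : ℝ) / b) * V := by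
        gcongr
        exact_mod_cast hx

/-- **The CM-Hermitian lift at conductor `r`: tangency sets of size `q^{3/2 − 1/(r−1)}`.**  For every prime `r ≥ 3` there
are `c > 0` and `q₀` such that for every prime `q ≥ q₀` with `q ≡ 1 (mod r)` the affine plane over `ZMod q` contains a
point set `V` with `|V| ≥ c · q^{3/2 − 1/(r−1)}` every point `v` of which lies on a line `{w : u ⬝ᵥ w = u ⬝ᵥ v}` (`u ≠ 0`)
meeting `V` only in `v` (an induced point–line matching of that size).  Construction: the Hermitian curves
`Y + Ȳ = 2XX̄ + const` over `ℤ[ζ_r]` with trace-zero heights, reduced modulo a degree-one prime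
(`exists_tangencySet_cyclotomicLift` with `C` maximal such that `(6r²+4r)^{r−1} C^{2(r−1)} < q`, `D = C²`).  Compare
Pohoata's real-subfield parabola lift (arXiv:2607.20422, Thm 1.3): exponent `3/2 − 2/(r−1)` on `q ≡ ±1 (mod r)`.
[this project] -/
theorem inducedMatchings_cmLift (r : ℕ) (hr : r.Prime) (hr3 : 3 ≤ r) :
    ∃ c : ℝ, 0 < c ∧ ∃ q₀ : ℕ, ∀ q : ℕ, q.Prime → q₀ ≤ q → q % r = 1 →
      ∃ V : Finset (Fin 2 → ZMod q), c * (q : ℝ) ^ ((3 : ℝ) / 2 - 1 / ((r : ℝ) - 1)) ≤ V.card ∧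
        ∀ v ∈ V, ∃ u : Fin 2 → ZMod q, u ≠ 0 ∧ ∀ w ∈ V, u ⬝ᵥ w = u ⬝ᵥ v → w = v := by
  classical
  -- the cyclotomic field `K = ℚ(ζ_r)` and its instances
  haveI : Fact r.Prime := ⟨hr⟩
  haveI : NeZero r := ⟨hr.ne_zero⟩
  haveI : NeZero ((r : ℕ) : ℚ) := ⟨Nat.cast_ne_zero.mpr hr.ne_zero⟩
  haveI hcyc : IsCyclotomicExtension {r} ℚ (CyclotomicField r ℚ) := CyclotomicField.isCyclotomicExtension r ℚ
  haveI : IsCMField (CyclotomicField r ℚ) :=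
    IsCyclotomicExtension.Rat.isCMField (CyclotomicField r ℚ) (S := {r}) ⟨r, Set.mem_singleton r, by omega⟩
  have hζ := IsCyclotomicExtension.zeta_spec r ℚ (CyclotomicField r ℚ)
  -- parameters
  set m : ℕ := r - 1 with hm
  have hm2 : 2 ≤ m := by omega
  set A : ℕ := (6 * r ^ 2 + 4 * r) ^ m with hA
  have hA1 : 1 ≤ A := Nat.one_le_pow _ _ (by nlinarith)
  set e : ℝ := ((3 * m - 2 : ℕ) : ℝ) / ((2 * m : ℕ) : ℝ) with he
  have heq : e = (3 : ℝ) / 2 - 1 / ((r : ℝ) - 1) := by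
    have hm' : ((3 * m - 2 : ℕ) : ℝ) = 3 * (m : ℝ) - 2 := by
      rw [Nat.cast_sub (by omega)]; push_cast; ring
    have hr' : (r : ℝ) - 1 = (m : ℝ) := by
      rw [hm, Nat.cast_sub hr.one_le]; push_cast; ring
    have hm0 : (m : ℝ) ≠ 0 := by exact_mod_cast (by omega : m ≠ 0)
    rw [he, hm', hr']
    push_cast
    field_simp
  refine ⟨((A * 4 ^ m : ℕ) : ℝ) ^ (-e), Real.rpow_pos_of_pos (by positivity) _, A + 2, ?_⟩
  intro q hq hq₀ hmod
  haveI : Fact q.Prime := ⟨hq⟩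
  -- `C` maximal with `A · C^{2m} < q`
  set C : ℕ := Nat.findGreatest (fun C => A * C ^ (2 * m) < q) q with hC
  have hPC : A * C ^ (2 * m) < q := by
    have h0 : A * 0 ^ (2 * m) < q := by
      rw [zero_pow (by omega), mul_zero]; exact hq.pos
    exact Nat.findGreatest_spec (P := fun C => A * C ^ (2 * m) < q) (Nat.zero_le q) h0
  have hC1 : 1 ≤ C := by
    refine Nat.le_findGreatest (P := fun C => A * C ^ (2 * m) < q) hq.one_le ?_
    show A * 1 ^ (2 * m) < q
    rw [one_pow, mul_one]; omega
  have hCq : C + 1 ≤ q := by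
    have hle : C ≤ q := Nat.findGreatest_le q
    rcases Nat.lt_or_ge C q with h | h
    · exact h
    · exfalso
      have hCeq : C = q := le_antisymm hle h
      have : q ≤ A * C ^ (2 * m) := by
        rw [hCeq]
        calc q = 1 * q ^ 1 := by ring
          _ ≤ A * q ^ (2 * m) := Nat.mul_le_mul hA1 (Nat.pow_le_pow_right hq.pos (by omega))
      omega
  have hmax : q ≤ A * (C + 1) ^ (2 * m) := by
    have := Nat.findGreatest_is_greatest (P := fun C => A * C ^ (2 * m) < q) (Nat.lt_succ_self C) hCq
    push Not at this
    exact this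
  have hmax' : q ≤ (A * 4 ^ m) * C ^ (2 * m) := by
    refine le_trans hmax ?_
    have h2 : (C + 1) ^ (2 * m) ≤ (2 * C) ^ (2 * m) := Nat.pow_le_pow_left (by omega) _
    calc A * (C + 1) ^ (2 * m) ≤ A * (2 * C) ^ (2 * m) := Nat.mul_le_mul_left _ h2
      _ = A * 4 ^ m * C ^ (2 * m) := by rw [mul_pow, pow_mul, mul_assoc]; norm_num
  -- the window `(6r²C² + 4rC²)^{r-1} = A · C^{2m} < q`
  have hwin : ((6 * r ^ 2 * C ^ 2 + 4 * r * (C ^ 2) : ℕ) : ℝ) ^ (r - 1) < q := by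
    have hnat : (6 * r ^ 2 * C ^ 2 + 4 * r * (C ^ 2)) ^ (r - 1) < q := by
      have : (6 * r ^ 2 * C ^ 2 + 4 * r * (C ^ 2)) ^ (r - 1) = A * C ^ (2 * m) := by
        rw [hA, ← hm, pow_mul, ← mul_pow]
        congr 1
        ring
      rw [this]; exact hPC
    exact_mod_cast hnat
  -- the lift
  obtain ⟨V, hV, htan⟩ := exists_tangencySet_cyclotomicLift hζ hmod C (C ^ 2) hwin
  refine ⟨V, ?_, htan⟩
  -- sizes: `|V| = C^{r-1} (C²)^{r-2} = C^{3m-2}` and `q ≤ (A 4^m) C^{2m}`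
  have hcard : C ^ (3 * m - 2) ≤ V.card := by
    rw [hV, ← pow_mul, ← pow_add]
    apply le_of_eq; congr 1; omega
  have key := rpow_div_le_of_pow_le (by omega : 2 * m ≠ 0) hcard hmax'
  rw [← he] at key
  rw [← heq]
  have hApos : (0 : ℝ) < ((A * 4 ^ m : ℕ) : ℝ) := by positivity
  calc ((A * 4 ^ m : ℕ) : ℝ) ^ (-e) * (q : ℝ) ^ e
      ≤ ((A * 4 ^ m : ℕ) : ℝ) ^ (-e) * (((A * 4 ^ m : ℕ) : ℝ) ^ e * V.card) :=
        mul_le_mul_of_nonneg_left key (Real.rpow_nonneg hApos.le _)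
    _ = V.card := by
        rw [← mul_assoc, ← Real.rpow_add hApos, neg_add_cancel, Real.rpow_zero, one_mul]

/-- **The CM-Hermitian lift in the stub's flag format, along the progression `1 (mod r)`.**  For every prime `r ≥ 3`
there are `c > 0` and `q₀` such that EVERY prime `p ≥ q₀` with `p ≡ 1 (mod r)` carries a strong representative system
of `AG(2,p)` — flags with `f.1 ⬝ᵥ f'.2 = 1 ↔ f = f'` — with at least `c · p^{3/2 − 1/(r−1)}` flags (the tangency set of
`inducedMatchings_cmLift` converted by `FlagLine.TangencyHermitian.srs_of_tangencySet`, which loses at most the factor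
`1 − 1/p ≥ 1/2`).  As `r → ∞` this is the stub at every exponent below `3/2` (for that corollary see
`ParabolaLift.stubFormat_near_threeHalves`, reached independently through the real subfield); exponent `3/2` itself is
open. [this project] -/
theorem stubFormat_cmLift_progression (r : ℕ) (hr : r.Prime) (hr3 : 3 ≤ r) :
    ∃ c : ℝ, 0 < c ∧ ∃ q₀ : ℕ, ∀ p : ℕ, p.Prime → q₀ ≤ p → p % r = 1 →
      ∃ S : Finset ((Fin 2 → ZMod p) × (Fin 2 → ZMod p)),
        c * (p : ℝ) ^ ((3 : ℝ) / 2 - 1 / ((r : ℝ) - 1)) ≤ S.card ∧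
        ∀ f ∈ S, ∀ f' ∈ S, (dotProduct f.1 f'.2 = 1 ↔ f = f') := by
  classical
  obtain ⟨c, hc, q₀, hq⟩ := inducedMatchings_cmLift r hr hr3
  refine ⟨c / 2, by positivity, q₀, fun p hp hp₀ hmod => ?_⟩
  haveI : Fact p.Prime := ⟨hp⟩
  obtain ⟨V, hV, htan⟩ := hq p hp hp₀ hmod
  choose! u hu using htan
  obtain ⟨S, hS, hsrs⟩ := FlagLine.TangencyHermitian.srs_of_tangencySet V u (fun v hv => (hu v hv).1)
    (fun v hv => (hu v hv).2)
  refine ⟨S, ?_, hsrs⟩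
  have hp2 : (2 : ℝ) ≤ p := by exact_mod_cast hp.two_le
  have hS' : (V.card : ℝ) * p ≤ S.card * p + V.card := by
    have := hS
    rw [ZMod.card] at this
    exact_mod_cast this
  have hSV : (V.card : ℝ) ≤ 2 * S.card := by nlinarith
  calc c / 2 * (p : ℝ) ^ ((3 : ℝ) / 2 - 1 / ((r : ℝ) - 1))
      = (c * (p : ℝ) ^ ((3 : ℝ) / 2 - 1 / ((r : ℝ) - 1))) / 2 := by ring
    _ ≤ V.card / 2 := by gcongr
    _ ≤ S.card := by linarith

end Summit.MatrixMultiplication.MatrixMultiplication.Theorems.LevelOneGL2Designs.HermitianLift
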